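import Literature.MathematicalPhysics.QuantumFieldTheory.Balaban1983to89.B9Eq315QTower

/-!
# `Balaban1983to89.B9Eq326OperatorTower` — T. Bałaban, *Propagators for lattice gauge theories in a background field*, Commun. Math. Phys. **99**
# (1985) 389–434 [Balaban1985BackgroundPropagators] (3.26) p. 395 with (3.15)–(3.16), (3.19)–(3.24) pp. 393–394: THE OPERATOR
# `Δ_a(U) = Δ(U) + D R(U) D* + Q_k*(U) a Q_k(U)` OF THE `k`-TH STEP — `R(U)` the projection onto `Δ_U N(Q′_k(U))` and `Q := Q_k(U)` the
# COMPOSITE averagings of the tower `T_{L^k m} → ⋯ → T_m` — assembled from the background, symmetric, with `G₁`/`H₁`/`𝔊` at it and «Q onto»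
# discharged at every number of levels

statement-level skeleton of published theorems with citation tags; proofs where landed; nothing here is a claim
about the Yang–Mills mass gap

PDF held: `paper:balaban1985-cmp99-background-propagators` (journal page = PDF page + 388), pp. 393–395; read by this seat (2026-08-21) in the held text
(verbatim quotations in `B9Eq326OperatorAssembly`, `B9Eq315QTorus`, `B9Eq315QTower`).

THE PRINT.  (3.16) p. 393: *«⟨A, Q*aQA⟩ = Σ_{j=0}^{k} a Σ_{b∈Λ_j} (L^jη)^{d−2} |(Q_j(U)A)(b)|²»*; (3.24) p. 394: *«⟨λ, Q′*aQ′λ⟩ = Σ_{j=0}^{k} a_j Σ_{y∈Λ_j}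
(L^jη)^{d−2} |(Q′_j(U)λ)(y)|²»*; (3.21) p. 394: *«R = R(U) is an orthogonal projection … onto the subspace ℛ = Δ^η_U N(Q′)»*; (3.26) p. 395:
*«Δ_a(U) = Δ(U) + D_U R(U) D*_U + Q*(U)aQ(U)»*.  In the small-field `k`-th step (no large-field regions, `Ω_j = T` for all `j`) only the level
`j = k` survives in (3.16)/(3.24): `Q = Q_k(U)`, `Q′ = Q′_k(U)` — the COMPOSITES of (3.15)/(3.19).

WHY THIS FILE (cell context).  `B9Eq326OperatorAssembly` (E159) / `B9Eq315QTorus` (E162) assembled `Δ_a(U)` with the ONE-STEP averagings (declared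
reading (M3) «one averaging level only»); `B9Eq315QTower` typed the composites `Q_k(U)` / `Q′_k` on the tower and proved them onto.  This file
repeats the assembly at `k = n+1` levels: the fine torus is `T_{L^{n+1} m}` (`towerP L m (n+1) = fineP L (towerP L m n)` definitionally, so every
letter of E154/E157 applies verbatim), the coarse (unit) torus is `T_m`.

WHAT IS DEFINED AND PROVED (sorry-free; no `Prop` placeholder; no inequality of the paper).
* `QprimeTowerW`, `QprimeTowerW_surjective` — `Q′_{n+1}(U)` on the `L²` gauge parameters (transporters of the averaged backgrounds `Ū^j`);
  **`RofUk`** — `R(U)` of (3.21) onto `Δ_U N(Q′_{n+1}(U))`; `RofUk_isSymmetric`.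
* **`QkW`** — `Q_{n+1}(U)` between the weighted `L²` spaces (`B9Eq315QTower.QkOfU` read along the fibre identification `φ`); **`QkW_surjective`**
  (per-level small-field regime).
* **`laplaceAk`** — (3.26) at `n+1` levels: `laplaceALatticeK` at `Δ₁ := hessOp φ η U τ`, `Rr := RofUk`, `Q := QkW`; **`laplaceAk_isSymmetric`**
  (unitary `U`, `*`-trace, two-normings compatibility — as E161).
* **`G1k`**, **`H1k`** (+ **`Q_H1k`** = (45)₁ `Q_{n+1}(H₁b) = b`), **`frakGk`** — the (L6)/(L2) letters at the `(n+1)`-level operator, «Q onto» DISCHARGED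
  by `QkW_surjective`; displayed: positivity of `laplaceAk` ([B9] Thm 3.11) only.
MODEL / DECLARED READINGS.  (M1)–(M2) as `B9Eq315QTower` / `B9Eq326OperatorAssembly` (per-level displayed background data, fibre readings `φ`/`τ`,
weights `c₀`, `c₁`, scalar `η⁻¹`).  (M3) one number `a` (print's (3.16)/(3.24) carry `a_j`, `(L^jη)^{d−2}` — at the single surviving level a
rescaling of `a`/`c₁`, cf. E162's `QtorusW` docstring).  (M4) the Hessian `Δ(U)` is the fine-lattice one (E157), independent of the number of levels.
HONEST SCOPE.  Assembly of the cell's own objects at printed formulas; no estimate; NOT summit progress (cell pub-balaban: NE9 NOT PRINTED / NOT PROVED;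
spine PROVED 0/9).  Filed by the pub-balaban NE9 BINDER-row owner lineage `b2b-balaban-t4-ne9-p1` (gen 78); NEW file importing `B9Eq315QTower`;
nothing modified.  Net new unproved facts: 0.
-/

noncomputable section

open scoped InnerProductSpace ComplexConjugate BigOperators

namespace Literature.MathematicalPhysics.QuantumFieldTheory.Balaban1983to89.B9Eq326OperatorTower

open B4Sect5Torus (TSite)
open B9SectCLatticeCarrier (Bond)
open B7Prop1Explicit (U1 Wcx boxVec)
open B9Eq311L2Pairing (WL2)
open B11Eq103H1Complex (SiteL2K BondL2K laplaceALatticeK laplaceALatticeK_isSymmetric RLatticeK RLatticeK_isSymmetric G1LatticeK H1LatticeK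
  Q_H1LatticeK frakGLatticeK)
open B9Eq310HessianOperator (adTransportW hessOp)
open B9Eq310HessianHermitian (adTransportW_adjoint hessOp_isSymmetric_of_trace)
open B9Eq319QprimeTorus (fineP)
open B9Eq315QTorus (perCfg cornerSite)
open B9Eq315QTower (towerP UlevOf QkOfU QkOfU_surjective QprimeTower QprimeTower_surjective)

variable {d : ℕ} (L : ℕ) [NeZero L] (m : Fin d → ℕ) [∀ i, NeZero (m i)] (n : ℕ)
  {𝔸 : Type*} [NormedRing 𝔸] [NormedAlgebra ℂ 𝔸] [CompleteSpace 𝔸] [NormOneClass 𝔸]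
  {W : Type*} [NormedAddCommGroup W] [InnerProductSpace ℂ W] (φ : W ≃ₗ[ℂ] 𝔸) {c₀ c₁ : ℝ} (η : ℝ)
  (U : Bond d (towerP L m (n + 1)) → 𝔸ˣ)

/-! ## §1 `Q′_{n+1}(U)` at `n+1` levels -/

/-- **`Q′_{n+1}(U)` of (3.19)/(3.24) on the `L²` gauge parameters of the fine torus `T_{L^{n+1} m}`**, valued on the unit torus `T_m`: the composite
`B9Eq315QTower.QprimeTower` at the transporters `R(Ū^j(b))` of the averaged backgrounds, composed with the identification of the weighted `L²`
space with the functions. [cite: Balaban1985BackgroundPropagators, (3.19) p.393, (3.24) p.394] -/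
def QprimeTowerW : SiteL2K ℂ d (towerP L m (n + 1)) c₀ W →ₗ[ℂ] (TSite d m → W) :=
  QprimeTower L m (fun j => adTransportW φ (UlevOf L m (n + 1) U j)) (n + 1) ∘ₗ
    (WL2.linearEquiv ℂ ℂ (fun _ : TSite d (towerP L m (n + 1)) => c₀)).toLinearMap

omit [NormOneClass 𝔸] in
/-- `Q′_{n+1}(U)` on the `L²` space is onto (unconditionally). [cite: Balaban1985BackgroundPropagators, (3.19) p.393] -/
theorem QprimeTowerW_surjective : Function.Surjective (QprimeTowerW L m n φ U (c₀ := c₀)) :=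
  (QprimeTower_surjective L m _ (n + 1)).comp (WL2.linearEquiv ℂ ℂ (fun _ : TSite d (towerP L m (n + 1)) => c₀)).surjective

/-! ## §2 `Q_{n+1}(U)` on the weighted `L²` spaces, and `R(U)` onto `Δ_U N(Q′_{n+1}(U))` -/

variable (hL : 1 ≤ L) (α : ℕ → ℝ) (hα1 : ∀ j, α j ≤ 1 / 64)
  (hU1 : ∀ (j : ℕ) (x : B7Prop1Explicit.Site d) (κ : Fin d), perCfg (towerP L m (j + 1)) (UlevOf L m (n + 1) U j) x κ ∈ U1 𝔸)
  (hreg : ∀ (j : ℕ) (y : TSite d (towerP L m j)) (κ : Fin d) (r : Fin d → Fin L),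
    ‖((Wcx L (perCfg (towerP L m (j + 1)) (UlevOf L m (n + 1) U j)) (cornerSite L y) κ (boxVec L r) : 𝔸ˣ) : 𝔸) - 1‖ ≤ α j)

/-- **`Q_{n+1}(U)` between the weighted `L²` spaces of `W`-valued bond functions** (fine weight `c₀`, unit-lattice weight `c₁`; `B9Eq315QTower.QkOfU`
read along `φ`). [cite: Balaban1985BackgroundPropagators, (3.15)–(3.16) p.393] -/
def QkW : BondL2K ℂ d (towerP L m (n + 1)) c₀ W →ₗ[ℂ] BondL2K ℂ d m c₁ W :=
  (WL2.linearEquiv ℂ ℂ (fun _ : Bond d m => c₁)).symm.toLinearMap ∘ₗ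
    (LinearEquiv.piCongrRight fun _ : Bond d m => φ.symm).toLinearMap ∘ₗ
      QkOfU L m hL (n + 1) U α hα1 hU1 hreg ∘ₗ
        (LinearEquiv.piCongrRight fun _ : Bond d (towerP L m (n + 1)) => φ).toLinearMap ∘ₗ
          (WL2.linearEquiv ℂ ℂ (fun _ : Bond d (towerP L m (n + 1)) => c₀)).toLinearMap

/-- **`Q_{n+1}(U)` on the `L²` spaces is onto** in the per-level small-field regime. [cite: Balaban1985BackgroundPropagators, (3.15) p.393, (3.126) p.420] -/
theorem QkW_surjective (hαL : ∀ j, 50 * (d + 1) * α j * (L : ℝ) ^ d ≤ 1 / 2) :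
    Function.Surjective (QkW L m n φ U hL α hα1 hU1 hreg (c₀ := c₀) (c₁ := c₁)) := by
  unfold QkW
  simp only [LinearMap.coe_comp]
  exact (LinearEquiv.surjective _).comp <| (LinearEquiv.surjective _).comp <| (QkOfU_surjective L m hL (n + 1) U α hα1 hU1 hreg hαL).comp <|
    (LinearEquiv.surjective _).comp (LinearEquiv.surjective _)

variable [FiniteDimensional ℂ W] [Fact (0 < c₀)]

/-- **`R(U)` of (3.21) AT `n+1` LEVELS**: the orthogonal projection onto `Δ_U N(Q′_{n+1}(U))` in the `L²` space of the gauge parameters of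
`T_{L^{n+1} m}`. [cite: Balaban1985BackgroundPropagators, (3.21)–(3.23) p.394] -/
def RofUk : SiteL2K ℂ d (towerP L m (n + 1)) c₀ W →ₗ[ℂ] SiteL2K ℂ d (towerP L m (n + 1)) c₀ W :=
  RLatticeK ((η : ℂ))⁻¹ (adTransportW φ U) (adTransportW φ fun b => (U b)⁻¹) (QprimeTowerW L m n φ U)

omit [NormOneClass 𝔸] in
/-- `R(U)` is symmetric. [cite: Balaban1985BackgroundPropagators, (3.21) p.394] -/
theorem RofUk_isSymmetric : (RofUk L m n φ η U (c₀ := c₀)).IsSymmetric := RLatticeK_isSymmetric _ _ _ _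

/-! ## §3 (3.26) at `n+1` levels, its symmetry, and the letters -/

variable [StarRing 𝔸] [StarModule ℂ 𝔸] [Fact (0 < c₁)] (τ : 𝔸 →ₗ[ℂ] ℂ)

/-- **(3.26) AT `n+1` LEVELS: `Δ_a(U) = Δ(U) + D R(U) D* + Q_{n+1}*(U) a Q_{n+1}(U)`** — the fine-lattice Hessian `hessOp`, `R(U)` onto `Δ_U N(Q′_{n+1}(U))`,
the composite averaging `Q_{n+1}(U)`; data: the number `a` and the displayed per-level background facts. [cite: Balaban1985BackgroundPropagators, (3.26) p.395] -/
def laplaceAk (a : ℝ) : BondL2K ℂ d (towerP L m (n + 1)) c₀ W →ₗ[ℂ] BondL2K ℂ d (towerP L m (n + 1)) c₀ W :=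
  laplaceALatticeK ((η : ℂ))⁻¹ (adTransportW φ U) (adTransportW φ fun b => (U b)⁻¹) (hessOp φ η U τ) (RofUk L m n φ η U)
    (QkW L m n φ U hL α hα1 hU1 hreg (c₁ := c₁)) a

/-- **`Δ_a(U)` at `n+1` levels IS SYMMETRIC** for a unitary background, a `*`-trace and the compatibility of the two normings (E161's mechanism).
[cite: Balaban1985BackgroundPropagators, (3.26) p.395, (3.10) p.392; Balaban1985Variational, p.293] -/
theorem laplaceAk_isSymmetric (hU : ∀ b, star (U b : 𝔸) = ((U b)⁻¹ : 𝔸ˣ)) (hτ₁ : ∀ X : 𝔸, τ (star X) = conj (τ X))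
    (hτ₂ : ∀ X Y : 𝔸, τ (X * Y) = τ (Y * X)) (hφ : ∀ X Y : 𝔸, ⟪φ.symm X, φ.symm Y⟫_ℂ = τ (star X * Y)) (a : ℝ) :
    (laplaceAk L m n φ η U hL α hα1 hU1 hreg τ (c₀ := c₀) (c₁ := c₁) a).IsSymmetric :=
  laplaceALatticeK_isSymmetric (by rw [map_inv₀, Complex.conj_ofReal]) (adTransportW_adjoint φ τ hτ₂ hU hφ)
    (hessOp_isSymmetric_of_trace φ τ hτ₁ hτ₂ η hU hφ) (RofUk_isSymmetric L m n φ η U)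

variable {a : ℝ} (hαL : ∀ j, 50 * (d + 1) * α j * (L : ℝ) ^ d ≤ 1 / 2)
  (hpos : ∀ x : BondL2K ℂ d (towerP L m (n + 1)) c₀ W, x ≠ 0 →
    0 < RCLike.re ⟪x, laplaceAk L m n φ η U hL α hα1 hU1 hreg τ (c₀ := c₀) (c₁ := c₁) a x⟫_ℂ)

/-- **`G₁(U) = Δ_a(U)⁻¹` at `n+1` levels** (positivity = [B9] Thm 3.11, displayed). [cite: Balaban1985Variational, (110) p.294; Balaban1985BackgroundPropagators, Thm 3.11 p.416] -/
def G1k : BondL2K ℂ d (towerP L m (n + 1)) c₀ W →ₗ[ℂ] BondL2K ℂ d (towerP L m (n + 1)) c₀ W := G1LatticeK hpos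

/-- **`H₁(U) = G₁Q*(QG₁Q*)⁻¹` at `n+1` levels — «Q onto» DISCHARGED (`QkW_surjective`).** [cite: Balaban1985BackgroundPropagators, (3.126) p.420; Balaban1985Variational, (45) p.285] -/
def H1k : BondL2K ℂ d m c₁ W →ₗ[ℂ] BondL2K ℂ d (towerP L m (n + 1)) c₀ W :=
  H1LatticeK hpos (QkW_surjective L m n φ U hL α hα1 hU1 hreg hαL)

/-- **(45)₁ `Q_{n+1}(U)(H₁(U) b) = b`** at `n+1` levels, given the displayed positivity and the per-level regime. [cite: Balaban1985Variational, (45) p.285] -/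
theorem Q_H1k (b : BondL2K ℂ d m c₁ W) :
    QkW L m n φ U hL α hα1 hU1 hreg (H1k L m n φ η U hL α hα1 hU1 hreg τ hαL hpos b) = b :=
  Q_H1LatticeK hpos _ b

/-- **`𝔊(U)`** of [B11] (110)–(111) / [B9] (3.153) at `n+1` levels, «Q onto» discharged. [cite: Balaban1985Variational, (110)–(111) p.294] -/
def frakGk : BondL2K ℂ d (towerP L m (n + 1)) c₀ W →ₗ[ℂ] BondL2K ℂ d (towerP L m (n + 1)) c₀ W :=
  frakGLatticeK hpos (QkW_surjective L m n φ U hL α hα1 hU1 hreg hαL)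

end Literature.MathematicalPhysics.QuantumFieldTheory.Balaban1983to89.B9Eq326OperatorTower

end
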